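import Mathlib
import HarnessLib
import Summits.RiemannHypothesis.RiemannHypothesis.Theorems.EvenSectorBartaEvenOneSignedWindowsFirstBirth

/-!
# First-birth lemma, LOCAL forms: the STEP on a parameter interval and the sampled-margin cover

pub-rhpf PF seat (mechanism search; **no RH claim**).  RULING A28 of the cell's adjudication log asked for two
things before the first-birth lemma (`forall_pos_of_noBirth`, global on `[a₀, ∞)`) may be cited as a STEP(I, H):

* (A28 (1)) the LOCAL step `I(a₀) ∧ H[a₀, a₁] ⇒ I` on `[a₀, a₁]`, where `I(a)` = "`u a` is strictly positive on the
  compact (rescaled, closed) window `X`" and `H[a₀, a₁]` = "the path is sup-norm continuous on `[a₀, a₁]` and no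
  window `b ∈ (a₀, a₁]` carries a nonnegative state with a zero".  This is `forall_pos_of_noBirth_on` /
  `pos_of_noBirth_on` below, obtained from the global lemma by the reparametrisation `t ↦ u (min t a₁)`.
* (A28 (3)) the only admissible DATA instance of `H` is an INTERVAL statement: sampled windows `c k` with margins
  `m k ≤ min u (c k)` and a modulus bound `dist (u a) (u (c k)) < m k` for `|a - c k| ≤ δ k`, the balls covering
  the range.  `forall_pos_of_marginCover` records that such a table gives strict positivity on the whole covered
  range by the triangle inequality alone (no continuity, no first-birth argument) — so a certified `(m k, δ k)`
  table IS the hypothesis `I` on the covered range, and "no zero at the sampled windows" without the modulus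
  column is not.

Nothing here is specific to the Weil form; the instance hypotheses (which path `u`, continuity = simplicity of
the ground state, the margins) stay exactly as labelled in the cell documents (DATA per window / OPEN in the
continuum).
-/

set_option linter.unusedVariables false
set_option linter.dupNamespace false

namespace Summit.RiemannHypothesis.RiemannHypothesis.Theorems.PolarPerronFrobenius

open Set

variable {X : Type*} [TopologicalSpace X] [CompactSpace X]

/-- LOCAL FIRST-BIRTH CONTRAPOSITIVE (RULING A28 (1)).  Along a path of continuous functions on a compact space,
sup-norm continuous on the parameter interval `[a₀, a₁]`, strictly positive at `a₀`, such that no parameter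
`b ∈ (a₀, a₁]` carries a nonnegative function with a zero: every function of the path on `[a₀, a₁]` is strictly
positive.  Proof: the global lemma `forall_pos_of_noBirth` applied to the frozen path `t ↦ u (min t a₁)`. -/
theorem forall_pos_of_noBirth_on (u : ℝ → C(X, ℝ)) (a₀ a₁ : ℝ) (hu : ContinuousOn u (Icc a₀ a₁))
    (h0 : ∀ x, 0 < u a₀ x)
    (hno : ∀ b, a₀ < b → b ≤ a₁ → (∀ x, 0 ≤ u b x) → ∀ x, u b x ≠ 0) :
    ∀ a, a₀ ≤ a → a ≤ a₁ → ∀ x, 0 < u a x := by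
  intro a ha ha₁ x
  have h01 : a₀ ≤ a₁ := ha.trans ha₁
  rcases h01.eq_or_lt with heq | hlt
  · -- degenerate interval: a = a₀ = a₁
    have : a = a₀ := le_antisymm (heq ▸ ha₁) ha
    rw [this]; exact h0 x
  · set v : ℝ → C(X, ℝ) := fun t => u (min t a₁) with hv
    have hmaps : MapsTo (fun t : ℝ => min t a₁) (Ici a₀) (Icc a₀ a₁) := by
      intro t ht
      exact ⟨le_min ht h01, min_le_right _ _⟩
    have hv_cont : ContinuousOn v (Ici a₀) :=
      hu.comp (continuous_id.min continuous_const).continuousOn hmaps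
    have hv0 : ∀ y, 0 < v a₀ y := by
      intro y
      show 0 < u (min a₀ a₁) y
      rw [min_eq_left h01]; exact h0 y
    have hvno : ∀ b, a₀ < b → (∀ y, 0 ≤ v b y) → ∀ y, v b y ≠ 0 := by
      intro b hb hnn y
      change ∀ y, 0 ≤ u (min b a₁) y at hnn
      show u (min b a₁) y ≠ 0
      rcases le_or_gt b a₁ with hb1 | hb1
      · rw [min_eq_left hb1] at hnn ⊢
        exact hno b hb hb1 hnn y
      · rw [min_eq_right hb1.le] at hnn ⊢
        exact hno a₁ hlt le_rfl hnn y
    have hpos := forall_pos_of_noBirth v a₀ hv_cont hv0 hvno a ha x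
    change 0 < u (min a a₁) x at hpos
    rwa [min_eq_left ha₁] at hpos

/-- STEP(I, H) on one parameter interval (the form RULING A28 names): `I(a₀) ∧ H[a₀, a₁] ⇒ I(a₁)`. -/
theorem pos_of_noBirth_on (u : ℝ → C(X, ℝ)) (a₀ a₁ : ℝ) (h01 : a₀ ≤ a₁)
    (hu : ContinuousOn u (Icc a₀ a₁)) (h0 : ∀ x, 0 < u a₀ x)
    (hno : ∀ b, a₀ < b → b ≤ a₁ → (∀ x, 0 ≤ u b x) → ∀ x, u b x ≠ 0) :
    ∀ x, 0 < u a₁ x :=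
  forall_pos_of_noBirth_on u a₀ a₁ hu h0 hno a₁ h01 le_rfl

/-- SAMPLED-MARGIN COVER (RULING A28 (3), the admissible DATA form of "no birth on a range").  If at sampled
parameters `c k` the functions have margins `m k` (`m k ≤ u (c k) x` for all `x`), if the path stays within
sup-distance `< m k` of `u (c k)` on the ball `|a - c k| ≤ δ k` (a modulus bound), and if these balls cover the
parameter set `S`, then every `u a`, `a ∈ S`, is strictly positive.  Triangle inequality only. -/
theorem forall_pos_of_marginCover {ι : Type*} (u : ℝ → C(X, ℝ)) (S : Set ℝ) (c δ m : ι → ℝ)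
    (hm : ∀ k x, m k ≤ u (c k) x)
    (hmod : ∀ k a, a ∈ S → |a - c k| ≤ δ k → dist (u a) (u (c k)) < m k)
    (hcover : ∀ a ∈ S, ∃ k, |a - c k| ≤ δ k) :
    ∀ a ∈ S, ∀ x, 0 < u a x := by
  intro a ha x
  obtain ⟨k, hk⟩ := hcover a ha
  have h1 : dist (u a x) (u (c k) x) ≤ dist (u a) (u (c k)) := ContinuousMap.dist_apply_le_dist x
  have h2 : dist (u a) (u (c k)) < m k := hmod k a ha hk
  rw [Real.dist_eq] at h1
  have h3 := (abs_lt.mp (lt_of_le_of_lt h1 h2)).1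
  have h4 := hm k x
  linarith

/-- The cover form also discharges the no-birth hypothesis itself on the covered set (strict positivity leaves
no nonnegative-with-a-zero window), so a certified `(m, δ)` table can be fed to `forall_pos_of_noBirth_on` on a
range it covers and continued beyond it by the step form. -/
theorem noBirth_of_marginCover {ι : Type*} (u : ℝ → C(X, ℝ)) (S : Set ℝ) (c δ m : ι → ℝ)
    (hm : ∀ k x, m k ≤ u (c k) x)
    (hmod : ∀ k a, a ∈ S → |a - c k| ≤ δ k → dist (u a) (u (c k)) < m k)
    (hcover : ∀ a ∈ S, ∃ k, |a - c k| ≤ δ k) :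
    ∀ b ∈ S, (∀ x, 0 ≤ u b x) → ∀ x, u b x ≠ 0 := by
  intro b hb _ x
  exact (forall_pos_of_marginCover u S c δ m hm hmod hcover b hb x).ne'

end Summit.RiemannHypothesis.RiemannHypothesis.Theorems.PolarPerronFrobenius
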